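import Literature.NumberTheory.LFunctions.WeilTwoPrimeOddMarginIBase
import Literature.NumberTheory.LFunctions.WeilTwoPrimeOddMarginIDataP7
import Literature.NumberTheory.LFunctions.WeilBlockRowsP
import HarnessLib

/-!
# Two-prime odd-margin certificate I: the materialized block agrees with `P_r`, rows 75–78

`WeilCert.checkPmRow` (row `k` of the claim `Pm_{kl} = P_r(2k+1, 2l+1)`) for rows 75–78 of certificate I, by `decide +kernel`. Pure proof file; nothing is asserted.
-/

noncomputable section

namespace Literature.NumberTheory.LFunctions

set_option maxHeartbeats 0 in
/-- Row 75 of the materialized block is row 75 of `P_r` (certificate I). [folklore] -/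
theorem checkPmRow1_75_weilCert23I : weilCert23IBase.checkPmRow weilCert23INu weilCert23IPm 1 75 = true := by
  decide +kernel

set_option maxHeartbeats 0 in
/-- Row 76 of the materialized block is row 76 of `P_r` (certificate I). [folklore] -/
theorem checkPmRow1_76_weilCert23I : weilCert23IBase.checkPmRow weilCert23INu weilCert23IPm 1 76 = true := by
  decide +kernel

set_option maxHeartbeats 0 in
/-- Row 77 of the materialized block is row 77 of `P_r` (certificate I). [folklore] -/
theorem checkPmRow1_77_weilCert23I : weilCert23IBase.checkPmRow weilCert23INu weilCert23IPm 1 77 = true := by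
  decide +kernel

set_option maxHeartbeats 0 in
/-- Row 78 of the materialized block is row 78 of `P_r` (certificate I). [folklore] -/
theorem checkPmRow1_78_weilCert23I : weilCert23IBase.checkPmRow weilCert23INu weilCert23IPm 1 78 = true := by
  decide +kernel

end Literature.NumberTheory.LFunctions
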